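import Literature.Computability.AlgebraicComplexity.SymmetricArithCircuit
import Mathlib.Data.Fintype.Sum
import Mathlib.Data.Fintype.Prod
import HarnessLib

/-!
# Symmetric circuits: the forward-mode gradient circuit (the circuit)

Topic `Computability/AlgebraicComplexity`, namespace `Literature.Computability.AlgebraicComplexity`.

A closure property of Dawar–Wilsenach symmetric arithmetic circuits
(`SymmetricArithCircuit.lean`: `LabelledArithCircuit` = Def. 2.2, `IsAutomorphismExtending` =
Def. 3.6, `IsSymmetric` = Def. 3.7 of A. Dawar, G. Wilsenach, *Symmetric Arithmetic Circuits*,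
Theory of Computing 21 (2025)): the GRADIENT of a symmetrically computed polynomial is computed
symmetrically, with outputs indexed by the variables. From a labelled circuit `P` over constants
`K` and variables `X` and a designated output index `y₀` this file builds ONE circuit
`LabelledArithCircuit.Gradient.gradCircuit P y₀` with outputs indexed by `X` whose output `x`
computes `∂/∂x` (`MvPolynomial.pderiv x`) of the polynomial computed by `P` at `y₀`, by
FORWARD-MODE differentiation (Baur–Strassen's reverse mode orders the children of a product
gate and is not equivariant; forward mode is, at a polynomial cost in size). Its semantics,
symmetry, size (`≤ (|G| + 1)² (|X| + 1) + 2` gates) and the packaged statement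
`LabelledArithCircuit.IsSymmetric.exists_gradient` are in `SymmetricCircuitGradientSymmetry.lean`.

Gates (`GradGate`): the old gates `old g` (value `v_g`); NEW constant gates for those of `0, 1`
that are not already the label of a (constant) gate of `P` (Def. 2.2 demands injective labels on
input gates, so existing constant gates are reused as SOURCES, `gradSrc`); for every gate `g`
and variable `x` an addition gate `der g x` (value `∂_x v_g`); for all gates `g, h` and every
variable `x` a multiplication gate `term g h x` (value `∂_x v_h · ∏_{h' ∈ child(g) ∖ {h}} v_h'`,
the Leibniz summand of the wire `(h, g)` of a product gate `g`; the gates with `h ∉ child(g)`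
are wired but unused). Wires (`gradWires`): `der g x` is the unary sum of the source of `1`,
resp. `0`, when `g` is the input `x`, resp. another input `x'` or a constant; the sum of the
`der h x`, `h ∈ child(g)`, when `g` is a sum; the sum of the `term g h x`, `h ∈ child(g)`, when
`g` is a product; and `term g h x` is the product of `der h x` and the old `h' ∈ child(g) ∖ {h}`.
Outputs: `x ↦ der (output y₀) x`. Everything is folklore and proved; nothing here is a named
fact.
-/

noncomputable section

open scoped Classical

namespace Literature.Computability.AlgebraicComplexity

universe u v w z

/-! ### Gates -/

/-- Gates of the gradient circuit over a circuit with gate type `G` and variables `X`: the old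
gates, new constant gates (`NC`), the partial derivatives `der g x` (`∂_x` of the value of `g`)
and the Leibniz summands `term g h x` (`∂_x v_h · ∏_{h' ∈ child(g) ∖ {h}} v_h'`).
[cite: DawarWilsenach2025, Def. 2.2] -/
inductive GradGate (G : Type w) (NC : Type u) (X : Type v) : Type (max u v w)
  | old (g : G) : GradGate G NC X
  | ncst (c : NC) : GradGate G NC X
  | der (g : G) (x : X) : GradGate G NC X
  | term (g h : G) (x : X) : GradGate G NC X

namespace GradGate

variable {G : Type w} {NC : Type u} {X : Type v}

/-- The gates as a sum of products (for counting). [cite: DawarWilsenach2025, Def. 2.2 (size)] -/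
def equivSum : GradGate G NC X ≃ (G ⊕ NC) ⊕ (G × X) ⊕ (G × G × X) where
  toFun
    | old g => Sum.inl (Sum.inl g)
    | ncst c => Sum.inl (Sum.inr c)
    | der g x => Sum.inr (Sum.inl (g, x))
    | term g h x => Sum.inr (Sum.inr (g, h, x))
  invFun
    | Sum.inl (Sum.inl g) => old g
    | Sum.inl (Sum.inr c) => ncst c
    | Sum.inr (Sum.inl p) => der p.1 p.2
    | Sum.inr (Sum.inr t) => term t.1 t.2.1 t.2.2
  left_inv s := by cases s <;> rfl
  right_inv t := by rcases t with (g | c) | (p | t) <;> rfl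

/-- Finitely many gates over finitely many old gates, constants and variables.
[cite: DawarWilsenach2025, Def. 2.2 (size)] -/
instance instFintype [Fintype G] [Fintype NC] [Fintype X] : Fintype (GradGate G NC X) :=
  Fintype.ofEquiv _ equivSum.symm

/-- The number of gates: `|G| + |NC| + |G|·|X| + |G|²·|X|`.
[cite: DawarWilsenach2025, Def. 2.2 (size)] -/
theorem card_eq [Fintype G] [Fintype NC] [Fintype X] :
    Fintype.card (GradGate G NC X) =
      Fintype.card G + Fintype.card NC + Fintype.card G * Fintype.card X +
        Fintype.card G * (Fintype.card G * Fintype.card X) := by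
  rw [Fintype.card_congr equivSum]
  simp only [Fintype.card_sum, Fintype.card_prod]
  ring

/-- `old` as an embedding (to map children sets). [cite: DawarWilsenach2025, Def. 2.2] -/
def oldEmb : G ↪ GradGate G NC X := ⟨old, fun _ _ => old.inj⟩

/-- `oldEmb` is `old`. [cite: DawarWilsenach2025, Def. 2.2] -/
@[simp] theorem oldEmb_apply (g : G) : (oldEmb : G ↪ GradGate G NC X) g = old g := rfl

/-- `h ↦ der h x` as an embedding. [cite: DawarWilsenach2025, Def. 2.2] -/
def derEmb (x : X) : G ↪ GradGate G NC X := ⟨fun h => der h x, fun _ _ e => (der.inj e).1⟩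

/-- `derEmb x h = der h x`. [cite: DawarWilsenach2025, Def. 2.2] -/
@[simp] theorem derEmb_apply (x : X) (h : G) : (derEmb x : G ↪ GradGate G NC X) h = der h x :=
  rfl

/-- `h ↦ term g h x` as an embedding. [cite: DawarWilsenach2025, Def. 2.2] -/
def termEmb (g : G) (x : X) : G ↪ GradGate G NC X :=
  ⟨fun h => term g h x, fun _ _ e => (term.inj e).2.1⟩

/-- `termEmb g x h = term g h x`. [cite: DawarWilsenach2025, Def. 2.2] -/
@[simp] theorem termEmb_apply (g : G) (x : X) (h : G) :
    (termEmb g x : G ↪ GradGate G NC X) h = term g h x := rfl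

/-- Relabelling the old gates by `π` and the variables by `σ`, fixing the new constants: the
candidate extension of an automorphism `π` over `σ`. [cite: DawarWilsenach2025, Def. 3.6] -/
def perm (π : Equiv.Perm G) (σ : Equiv.Perm X) : Equiv.Perm (GradGate G NC X) where
  toFun
    | old g => old (π g)
    | ncst c => ncst c
    | der g x => der (π g) (σ x)
    | term g h x => term (π g) (π h) (σ x)
  invFun
    | old g => old (π.symm g)
    | ncst c => ncst c
    | der g x => der (π.symm g) (σ.symm x)
    | term g h x => term (π.symm g) (π.symm h) (σ.symm x)
  left_inv s := by cases s <;> simp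
  right_inv s := by cases s <;> simp

end GradGate

/-! ### The construction -/

namespace LabelledArithCircuit

namespace Gradient

variable {K : Type u} {X : Type v} {Y : Type z} {G : Type w} [CommSemiring K]
  (P : LabelledArithCircuit K X Y G)

variable (K) in
/-- The constants used by the gradient circuit: `0`, `1`. [cite: DawarWilsenach2025, Def. 2.2] -/
def gradCset : Finset K := {0, 1}

/-- `0, 1 ∈ gradCset K`. [cite: DawarWilsenach2025, Def. 2.2] -/
theorem mem_gradCset : (0 : K) ∈ gradCset K ∧ (1 : K) ∈ gradCset K := by simp [gradCset]

/-- The constants of `gradCset K` with no constant gate in `P` (these get NEW constant gates).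
[cite: DawarWilsenach2025, Def. 2.2] -/
def GradNC : Type u := {c : K // c ∈ gradCset K ∧ ∀ g, P.label g ≠ .const c}

/-- `GradNC` is finite (a subset of `gradCset K`). [cite: DawarWilsenach2025, Def. 2.2 (size)] -/
instance instFintypeGradNC : Fintype (GradNC P) :=
  Fintype.subtype ((gradCset K).filter fun c => ∀ g, P.label g ≠ .const c) (fun c => by
    simp [Finset.mem_filter])

/-- The gate type of the gradient circuit. [cite: DawarWilsenach2025, Def. 2.2] -/
abbrev GGate : Type (max u v w) := GradGate G (GradNC P) X

variable {P}

/-- The gate sourcing the constant `c ∈ gradCset K`: the old gate labelled `c` if there is one,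
else the new one. [cite: DawarWilsenach2025, Def. 2.2] -/
def gradSrc (c : K) (hc : c ∈ gradCset K) : GGate P :=
  if h : ∃ g, P.label g = .const c then .old h.choose else .ncst ⟨c, hc, not_exists.mp h⟩

variable (P)

/-- The source of the constant `0`. [cite: DawarWilsenach2025, Def. 2.2] -/
def srcZero : GGate P := gradSrc 0 mem_gradCset.1

/-- The source of the constant `1`. [cite: DawarWilsenach2025, Def. 2.2] -/
def srcOne : GGate P := gradSrc 1 mem_gradCset.2

/-- Children of the derivative gate `der g x` according to the label of `g` (module docstring):
`∂_x x' ∈ {1, 0}`, `∂_x c = 0`, `∂_x Σ_h v_h = Σ_h ∂_x v_h`, `∂_x ∏_h v_h = Σ_h term g h x`.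
[cite: DawarWilsenach2025, Def. 2.2] -/
def derWires (x : X) (g : G) : CircuitLabel K X → Finset (GGate P)
  | .var x' => {if x' = x then srcOne P else srcZero P}
  | .const _ => {srcZero P}
  | .add => (P.children g).map (GradGate.derEmb x)
  | .mul => (P.children g).map (GradGate.termEmb g x)

/-- Children in the gradient circuit (module docstring). [cite: DawarWilsenach2025, Def. 2.2] -/
def gradWires : GGate P → Finset (GGate P)
  | .old g => (P.children g).map GradGate.oldEmb
  | .ncst _ => ∅
  | .der g x => derWires P x g (P.label g)
  | .term g h x => insert (.der h x) (((P.children g).erase h).map GradGate.oldEmb)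

/-- Labels in the gradient circuit: old labels, new constants, `+` on derivative gates, `×` on
Leibniz summands. [cite: DawarWilsenach2025, Def. 2.2] -/
def gradLabel : GGate P → CircuitLabel K X
  | .old g => P.label g
  | .ncst c => .const c.1
  | .der _ _ => .add
  | .term _ _ _ => .mul

variable {P}

/-- `gradSrc c` is labelled `c`. [cite: DawarWilsenach2025, Def. 2.2] -/
theorem gradLabel_gradSrc (c : K) (hc : c ∈ gradCset K) :
    gradLabel P (gradSrc c hc) = .const c := by
  unfold gradSrc
  split_ifs with h
  · exact h.choose_spec
  · rfl

/-- `gradSrc c` is an input gate. [cite: DawarWilsenach2025, Def. 2.2] -/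
theorem gradWires_gradSrc (c : K) (hc : c ∈ gradCset K) : gradWires P (gradSrc c hc) = ∅ := by
  unfold gradSrc
  split_ifs with h
  · have h1 : (P.label h.choose).IsInput := by rw [h.choose_spec]; trivial
    simp [gradWires, (P.isInput_iff _).1 h1]
  · rfl

/-- Children of a derivative gate. [cite: DawarWilsenach2025, Def. 2.2] -/
theorem gradWires_der (g : G) (x : X) : gradWires P (.der g x) = derWires P x g (P.label g) :=
  rfl

/-- A derivative gate has a child (sources, or the nonempty children of an internal gate).
[cite: DawarWilsenach2025, Def. 2.2] -/
theorem derWires_nonempty (x : X) (g : G) (l : CircuitLabel K X) (hl : P.label g = l) :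
    (derWires P x g l).Nonempty := by
  have hne : ¬ (P.label g).IsInput → (P.children g).Nonempty := fun hi =>
    Finset.nonempty_iff_ne_empty.2 fun h0 => hi ((P.isInput_iff g).2 h0)
  cases l with
  | var x' => exact ⟨_, Finset.mem_singleton_self _⟩
  | const c => exact ⟨_, Finset.mem_singleton_self _⟩
  | add => simp only [derWires, Finset.map_nonempty]; exact hne (by rw [hl]; simp)
  | mul => simp only [derWires, Finset.map_nonempty]; exact hne (by rw [hl]; simp)

/-! #### Acyclicity -/

/-- Old gates are accessible (acyclicity of `P`). [cite: DawarWilsenach2025, Def. 2.2] -/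
theorem gradAcc_old (g : G) : Acc (fun s t : GGate P => s ∈ gradWires P t) (.old g) := by
  induction g using P.wf.induction with
  | h g ih =>
    refine Acc.intro _ fun s hs => ?_
    simp only [gradWires, Finset.mem_map, GradGate.oldEmb_apply] at hs
    obtain ⟨h, hh, rfl⟩ := hs
    exact ih h hh

/-- Gates without children are accessible. [cite: DawarWilsenach2025, Def. 2.2] -/
theorem acc_of_gradWires_eq_empty {s : GGate P} (h : gradWires P s = ∅) :
    Acc (fun s t : GGate P => s ∈ gradWires P t) s :=
  Acc.intro _ fun t ht => by simp [h] at ht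

/-- Constant sources are accessible. [cite: DawarWilsenach2025, Def. 2.2] -/
theorem acc_gradSrc (c : K) (hc : c ∈ gradCset K) :
    Acc (fun s t : GGate P => s ∈ gradWires P t) (gradSrc c hc) :=
  acc_of_gradWires_eq_empty (gradWires_gradSrc c hc)

/-- A Leibniz summand is accessible once its derivative child is.
[cite: DawarWilsenach2025, Def. 2.2] -/
theorem gradAcc_term_of_der {h : G} {x : X}
    (hd : Acc (fun s t : GGate P => s ∈ gradWires P t) (.der h x)) (g : G) :
    Acc (fun s t : GGate P => s ∈ gradWires P t) (.term g h x) := by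
  refine Acc.intro _ fun s hs => ?_
  simp only [gradWires, Finset.mem_insert, Finset.mem_map, GradGate.oldEmb_apply] at hs
  rcases hs with rfl | ⟨h', -, rfl⟩
  · exact hd
  · exact gradAcc_old h'

/-- Derivative gates are accessible (induction along the wires of `P`: below `der g x` lie
sources, or `der h x`, or `term g h x` above `der h x`, for children `h` of `g`).
[cite: DawarWilsenach2025, Def. 2.2] -/
theorem gradAcc_der (g : G) (x : X) : Acc (fun s t : GGate P => s ∈ gradWires P t) (.der g x) := by
  induction g using P.wf.induction with
  | h g ih =>
    refine Acc.intro _ fun s hs => ?_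
    rw [gradWires_der] at hs
    rcases hl : P.label g with x' | c | _ | _ <;> rw [hl] at hs
    · simp only [derWires, Finset.mem_singleton] at hs
      rw [hs]
      split_ifs <;> exact acc_gradSrc _ _
    · simp only [derWires, Finset.mem_singleton] at hs
      rw [hs]
      exact acc_gradSrc _ _
    · simp only [derWires, Finset.mem_map, GradGate.derEmb_apply] at hs
      obtain ⟨h, hh, rfl⟩ := hs
      exact ih h hh
    · simp only [derWires, Finset.mem_map, GradGate.termEmb_apply] at hs
      obtain ⟨h, hh, rfl⟩ := hs
      exact gradAcc_term_of_der (ih h hh) g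

/-- Leibniz summands are accessible. [cite: DawarWilsenach2025, Def. 2.2] -/
theorem gradAcc_term (g h : G) (x : X) :
    Acc (fun s t : GGate P => s ∈ gradWires P t) (.term g h x) :=
  gradAcc_term_of_der (gradAcc_der h x) g

/-- The child relation of the gradient circuit is well founded.
[cite: DawarWilsenach2025, Def. 2.2] -/
theorem gradWires_wf : WellFounded fun s t : GGate P => s ∈ gradWires P t :=
  ⟨fun s => by
    cases s with
    | old g => exact gradAcc_old g
    | ncst c => exact acc_of_gradWires_eq_empty rfl
    | der g x => exact gradAcc_der g x
    | term g h x => exact gradAcc_term g h x⟩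

/-! #### The labelled circuit -/

/-- Input labels exactly at the gates without children. [cite: DawarWilsenach2025, Def. 2.2] -/
theorem isInput_gradLabel_iff (s : GGate P) : (gradLabel P s).IsInput ↔ gradWires P s = ∅ := by
  cases s with
  | old g => simp only [gradLabel, gradWires, Finset.map_eq_empty]; exact P.isInput_iff g
  | ncst c => simp [gradLabel, gradWires]
  | der g x =>
    simp only [gradLabel, CircuitLabel.not_isInput_add, false_iff]
    exact (derWires_nonempty x g _ rfl).ne_empty
  | term g h x =>
    simp only [gradLabel, CircuitLabel.not_isInput_mul, false_iff]
    exact Finset.insert_ne_empty _ _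

/-- Labels are injective on input gates (the input gates are old input gates and new constant
gates carrying constants absent from `P`). [cite: DawarWilsenach2025, Def. 2.2] -/
theorem eq_of_gradLabel_eq (s t : GGate P) (hs : (gradLabel P s).IsInput)
    (hst : gradLabel P s = gradLabel P t) : s = t := by
  cases s with
  | old g =>
    change (P.label g).IsInput at hs
    cases t with
    | old g' => exact congrArg GradGate.old (P.eq_of_label_eq g g' hs hst)
    | ncst c => exact absurd hst (c.2.2 g)
    | _ => simp only [gradLabel] at hst; rw [hst] at hs; exact absurd hs (by simp)
  | ncst c =>
    cases t with
    | old g => exact absurd hst.symm (c.2.2 g)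
    | ncst c' =>
      simp only [gradLabel, CircuitLabel.const.injEq] at hst
      exact congrArg GradGate.ncst (Subtype.ext hst)
    | _ => simp [gradLabel] at hst
  | _ => exact absurd hs (by simp [gradLabel])

variable (P) (y₀ : Y)

/-- **The gradient circuit** of `P` at the output index `y₀` (module docstring): on top of `P`,
the derivative gates `der g x` and the Leibniz summands `term g h x`; the output indexed by the
variable `x` is `der (output y₀) x` (value: `∂_x` of the polynomial computed at `y₀`,
`SymmetricCircuitGradientSymmetry.lean`). [cite: DawarWilsenach2025, Def. 2.2] -/
def gradCircuit : LabelledArithCircuit K X X (GGate P) where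
  children := gradWires P
  label := gradLabel P
  output := fun x => .der (P.output y₀) x
  wf := gradWires_wf
  isInput_iff := isInput_gradLabel_iff
  eq_of_label_eq := eq_of_gradLabel_eq
  output_injective := fun _ _ e => (GradGate.der.inj e).2

end Gradient

end LabelledArithCircuit

end Literature.Computability.AlgebraicComplexity

end
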